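import Mathlib

/-!
# `MatrixDescartes` (stmt-ValiantsHypothesis-18050), line `Lift` — the STIELTJES LAYER of the V-law / fan law
# (rpow-free Stieltjes representation of `u ↦ u^b` in the variable `w = u^{-a}`, `0 < b < a` naturals)

HONEST FRAMING.  Cell `pub-symmetroid`, seat `val-sym-mdr-p2` (gen 2); helper `--supports` the crux
`Theses.LacunarySymmetroid.MatrixDescartes` with NO closure claim.  This file is the ANALYSIS INPUT of the kernel proof
of the registered research stub `stub_vLaw` (`Cruxes/MatrixDescartes/Lines/Lift.lean`; paper proof = evidence
`VLAW-PROOF.md` on the crux item, predecessor seat g0; desk R1345) and of its fan generalisation (companion files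
`…VLawNormalForm.lean`, `…FanLaw.lean`).  Nothing here bears on the crux, `DoorA26`/`DoorA34`, or `VP ≠ VNP`.

THE POINT.  Lemma FULL of the paper proof factors the compressed pencil through the Stieltjes function
`w ↦ w^{-b/a}` (`0 < b < a`).  Because the exponents of a lacunary pencil are NATURAL numbers, the representation
can be written without real powers and without a singularity at `0`: for `n + b + 1 = a` and `u > 0`,

  `u ^ b * C = ∫_{ρ>0} ρ^n / ((u^a)⁻¹ + ρ^a) dρ`,   `(b/a) * u^(a+b) * C = ∫_{ρ>0} ρ^n / ((u^a)⁻¹ + ρ^a)^2 dρ`,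

where `C = ∫_{ρ>0} ρ^n/(1+ρ^a) dρ ∈ (0, ∞)` (`integral_stieltjes_one`, `integral_stieltjes_sq`, `stieltjesConst_pos`):
the first by the substitution `ρ ↦ u ρ` (`MeasureTheory.integral_comp_mul_left_Ioi`), the second by the same
substitution and the integration-by-parts identity `a ∫ ρ^n/(1+ρ^a)^2 = b ∫ ρ^n/(1+ρ^a)`
(`MeasureTheory.integral_Ioi_of_hasDerivAt_of_tendsto` applied to `ρ^(n+1)/(1+ρ^a)`).  All integrands are
dominated by a multiple of `(1+ρ²)⁻¹` on `(0, ∞)` (`integrableOn_stieltjes`).  [folklore] Stieltjes / Euler Beta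
integrals; elementary real analysis, Mathlib only.
-/

-- layout Summits/ValiantsHypothesis/ValiantsHypothesis forces the duplicated namespace component
set_option linter.dupNamespace false

namespace Summit.ValiantsHypothesis.ValiantsHypothesis.Theorems.LacunarySymmetroidMatrixDescartes

open MeasureTheory Set Filter Topology
open scoped BigOperators

namespace VLawStieltjes

/-! ## Pointwise bounds and integrability on `(0, ∞)` -/

/-- For `w > 0` and `ρ ≥ 0`, the Stieltjes denominator `w + ρ^a` is positive. [folklore] -/
theorem den_pos {w : ℝ} (hw : 0 < w) (a : ℕ) {ρ : ℝ} (hρ : 0 ≤ ρ) : 0 < w + ρ ^ a :=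
  add_pos_of_pos_of_nonneg hw (pow_nonneg hρ a)

/-- The basic domination: for `n + 2 ≤ a`, `w > 0`, `ρ > 0`,
`ρ^n / (w + ρ^a) ≤ 2 (w⁻¹ + 1) (1 + ρ²)⁻¹`. [folklore] -/
theorem stieltjes_le_inv_one_add_sq {n a : ℕ} (hna : n + 2 ≤ a) {w : ℝ} (hw : 0 < w) {ρ : ℝ}
    (hρ : 0 < ρ) : ρ ^ n / (w + ρ ^ a) ≤ 2 * (w⁻¹ + 1) * (1 + ρ ^ 2)⁻¹ := by
  have hden : 0 < w + ρ ^ a := den_pos hw a hρ.le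
  have h1 : 0 < 1 + ρ ^ 2 := by positivity
  rcases le_or_gt ρ 1 with hρ1 | hρ1
  · -- `ρ ≤ 1`: the left side is at most `w⁻¹`, the right side at least `w⁻¹ + 1`
    have hL : ρ ^ n / (w + ρ ^ a) ≤ w⁻¹ := by
      rw [div_le_iff₀ hden]
      have hpn : ρ ^ n ≤ 1 := pow_le_one₀ hρ.le hρ1
      have : w⁻¹ * (w + ρ ^ a) = 1 + w⁻¹ * ρ ^ a := by field_simp
      rw [this]
      have : 0 ≤ w⁻¹ * ρ ^ a := by positivity
      linarith
    have hR : w⁻¹ + 1 ≤ 2 * (w⁻¹ + 1) * (1 + ρ ^ 2)⁻¹ := by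
      rw [← div_eq_mul_inv, le_div_iff₀ h1]
      have hsq : ρ ^ 2 ≤ 1 := pow_le_one₀ hρ.le hρ1
      have hw1 : 0 < w⁻¹ + 1 := by positivity
      nlinarith
    have hw0 : (0 : ℝ) ≤ 1 := zero_le_one
    linarith [inv_pos.2 hw]
  · -- `ρ > 1`: the left side is at most `(ρ^2)⁻¹ ≤ 2 (1 + ρ²)⁻¹`
    have hρ2 : 0 < ρ ^ 2 := by positivity
    have hL : ρ ^ n / (w + ρ ^ a) ≤ (ρ ^ 2)⁻¹ := by
      rw [div_le_iff₀ hden, ← div_eq_inv_mul, le_div_iff₀ hρ2]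
      obtain ⟨c, hc⟩ := Nat.exists_eq_add_of_le hna
      rw [hc, pow_add, pow_add]
      have hc1 : 1 ≤ ρ ^ c := one_le_pow₀ hρ1.le
      have h0 : 0 ≤ ρ ^ n * ρ ^ 2 := by positivity
      nlinarith [mul_le_mul_of_nonneg_left hc1 h0]
    have hR : (ρ ^ 2)⁻¹ ≤ 2 * (w⁻¹ + 1) * (1 + ρ ^ 2)⁻¹ := by
      rw [← div_eq_mul_inv, le_div_iff₀ h1, ← one_div, div_mul_eq_mul_div, one_mul,
        div_le_iff₀ hρ2]
      have hw1 : 0 ≤ w⁻¹ := le_of_lt (inv_pos.2 hw)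
      nlinarith
    exact hL.trans hR

/-- Continuity of `ρ ↦ ρ^n / (w + ρ^a)` on `[0, ∞)` for `w > 0`. [folklore] -/
theorem continuousOn_stieltjes (n a : ℕ) {w : ℝ} (hw : 0 < w) :
    ContinuousOn (fun ρ : ℝ => ρ ^ n / (w + ρ ^ a)) (Ici 0) := by
  refine ContinuousOn.div (by fun_prop) (by fun_prop) fun ρ hρ => ?_
  exact (den_pos hw a hρ).ne'

/-- Continuity of `ρ ↦ (w + ρ^a)⁻¹` on `[0, ∞)` for `w > 0`. [folklore] -/
theorem continuousOn_inv_den (a : ℕ) {w : ℝ} (hw : 0 < w) :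
    ContinuousOn (fun ρ : ℝ => (w + ρ ^ a)⁻¹) (Ici 0) := by
  refine ContinuousOn.inv₀ (by fun_prop) fun ρ hρ => ?_
  exact (den_pos hw a hρ).ne'

/-- Bound `0 ≤ (w + ρ^a)⁻¹ ≤ w⁻¹` on `[0, ∞)`. [folklore] -/
theorem inv_den_le {a : ℕ} {w : ℝ} (hw : 0 < w) {ρ : ℝ} (hρ : 0 ≤ ρ) :
    0 ≤ (w + ρ ^ a)⁻¹ ∧ (w + ρ ^ a)⁻¹ ≤ w⁻¹ :=
  ⟨inv_nonneg.2 (den_pos hw a hρ).le,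
    inv_anti₀ hw (le_add_of_nonneg_right (pow_nonneg hρ a))⟩

/-- **Integrability.**  For `n + 2 ≤ a` and `w > 0`, `ρ ↦ ρ^n/(w + ρ^a)` is integrable on `(0, ∞)`
(dominated by `2(w⁻¹+1)(1+ρ²)⁻¹`, Mathlib `integrable_inv_one_add_sq`). [folklore] -/
theorem integrableOn_stieltjes {n a : ℕ} (hna : n + 2 ≤ a) {w : ℝ} (hw : 0 < w) :
    IntegrableOn (fun ρ : ℝ => ρ ^ n / (w + ρ ^ a)) (Ioi 0) := by
  have hg : IntegrableOn (fun ρ : ℝ => 2 * (w⁻¹ + 1) * (1 + ρ ^ 2)⁻¹) (Ioi 0) :=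
    (integrable_inv_one_add_sq.const_mul _).integrableOn
  refine Integrable.mono' hg ?_ ?_
  · exact ((continuousOn_stieltjes n a hw).mono Ioi_subset_Ici_self).aestronglyMeasurable
      measurableSet_Ioi
  · refine ae_restrict_of_forall_mem measurableSet_Ioi fun ρ hρ => ?_
    rw [Real.norm_eq_abs, abs_of_nonneg (div_nonneg (pow_nonneg hρ.out.le n)
      (den_pos hw a hρ.out.le).le)]
    exact stieltjes_le_inv_one_add_sq hna hw hρ

/-- Integrability survives multiplication by a factor that is continuous and bounded on `(0, ∞)`. [folklore] -/
theorem integrableOn_stieltjes_mul {n a : ℕ} (hna : n + 2 ≤ a) {w : ℝ} (hw : 0 < w) {g : ℝ → ℝ}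
    (hg : ContinuousOn g (Ioi 0)) {B : ℝ} (hB : ∀ ρ, 0 < ρ → |g ρ| ≤ B) :
    IntegrableOn (fun ρ : ℝ => ρ ^ n / (w + ρ ^ a) * g ρ) (Ioi 0) := by
  refine Integrable.mul_bdd (c := B) (integrableOn_stieltjes hna hw)
    (hg.aestronglyMeasurable measurableSet_Ioi) ?_
  exact ae_restrict_of_forall_mem measurableSet_Ioi fun ρ hρ => by
    rw [Real.norm_eq_abs]; exact hB ρ hρ

/-- The squared-denominator integrand `ρ^n/(w+ρ^a)^2 = ρ^n/(w+ρ^a) · (w+ρ^a)⁻¹` is integrable on `(0,∞)`.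
[folklore] -/
theorem integrableOn_stieltjes_sq {n a : ℕ} (hna : n + 2 ≤ a) {w : ℝ} (hw : 0 < w) :
    IntegrableOn (fun ρ : ℝ => ρ ^ n / (w + ρ ^ a) ^ 2) (Ioi 0) := by
  have h := integrableOn_stieltjes_mul hna hw ((continuousOn_inv_den a hw).mono Ioi_subset_Ici_self)
    (B := w⁻¹) fun ρ hρ => by
      rw [abs_of_nonneg (inv_den_le hw hρ.le).1]; exact (inv_den_le hw hρ.le).2
  refine h.congr_fun (fun ρ _ => ?_) measurableSet_Ioi
  rw [pow_two, div_mul_eq_div_div, div_eq_mul_inv]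

/-! ## The constant `C = ∫ ρ^n/(1+ρ^a)` is positive -/

/-- `0 < ∫_{ρ>0} ρ^n/(1+ρ^a) dρ` for `n + 2 ≤ a`. [folklore] -/
theorem stieltjesConst_pos {n a : ℕ} (hna : n + 2 ≤ a) :
    0 < ∫ ρ in Ioi (0:ℝ), ρ ^ n / (1 + ρ ^ a) := by
  have hint := integrableOn_stieltjes hna one_pos
  rw [setIntegral_pos_iff_support_of_nonneg_ae ?_ hint]
  · have hsub : Ioi (0:ℝ) ⊆ Function.support (fun ρ : ℝ => ρ ^ n / (1 + ρ ^ a)) ∩ Ioi 0 := by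
      intro ρ hρ
      refine ⟨?_, hρ⟩
      rw [Function.mem_support]
      exact (div_pos (pow_pos hρ.out n) (den_pos one_pos a hρ.out.le)).ne'
    calc (0 : ENNReal) < volume (Ioi (0:ℝ)) := by rw [Real.volume_Ioi]; exact ENNReal.zero_lt_top
      _ ≤ _ := measure_mono hsub
  · exact ae_restrict_of_forall_mem measurableSet_Ioi fun ρ hρ =>
      div_nonneg (pow_nonneg hρ.out.le n) (den_pos one_pos a hρ.out.le).le


/-! ## The scaling identities (substitution `ρ ↦ u ρ`) -/

/-- Pointwise scaling for the first identity: for `n + b + 1 = a`, `u > 0`, `ρ > 0`,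
`ρ^n/((u^a)⁻¹ + ρ^a) = u^(b+1) · ((uρ)^n/(1+(uρ)^a))`. [folklore] -/
theorem stieltjes_scale_one {n a b : ℕ} (hnab : n + b + 1 = a) {u ρ : ℝ} (hu : 0 < u) (hρ : 0 < ρ) :
    ρ ^ n / ((u ^ a)⁻¹ + ρ ^ a) = u ^ (b + 1) * ((u * ρ) ^ n / (1 + (u * ρ) ^ a)) := by
  have hua : 0 < u ^ a := pow_pos hu a
  have hd1 : (u ^ a)⁻¹ + ρ ^ a ≠ 0 := (den_pos (inv_pos.2 hua) a hρ.le).ne'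
  have hd2 : 1 + (u * ρ) ^ a ≠ 0 := (den_pos one_pos a (mul_pos hu hρ).le).ne'
  have hu0 : u ≠ 0 := hu.ne'
  have hua0 : u ^ a ≠ 0 := hua.ne'
  subst hnab
  field_simp
  ring

/-- **First Stieltjes identity**: `∫_{ρ>0} ρ^n/((u^a)⁻¹ + ρ^a) dρ = u^b · ∫_{ρ>0} ρ^n/(1+ρ^a) dρ` for
`n + b + 1 = a`, `u > 0` (i.e. `u^b = C⁻¹ ∫ ρ^n dρ/(u^{-a} + ρ^a)`: the function `w ↦ w^{-b/a}` at `w = u^{-a}` as a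
Stieltjes transform, written with natural powers only). [folklore] -/
theorem integral_stieltjes_one {n a b : ℕ} (hnab : n + b + 1 = a) {u : ℝ} (hu : 0 < u) :
    ∫ ρ in Ioi (0:ℝ), ρ ^ n / ((u ^ a)⁻¹ + ρ ^ a)
      = u ^ b * ∫ ρ in Ioi (0:ℝ), ρ ^ n / (1 + ρ ^ a) := by
  have hcongr : EqOn (fun ρ : ℝ => ρ ^ n / ((u ^ a)⁻¹ + ρ ^ a))
      (fun ρ => u ^ (b + 1) * ((fun x : ℝ => x ^ n / (1 + x ^ a)) (u * ρ))) (Ioi 0) :=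
    fun ρ hρ => stieltjes_scale_one hnab hu hρ
  rw [setIntegral_congr_fun measurableSet_Ioi hcongr, integral_const_mul,
    integral_comp_mul_left_Ioi (fun x : ℝ => x ^ n / (1 + x ^ a)) 0 hu, mul_zero, smul_eq_mul,
    ← mul_assoc, pow_succ, mul_assoc (u ^ b), mul_inv_cancel₀ hu.ne', mul_one]

/-- Pointwise scaling for the second identity: for `n + b + 1 = a`, `u > 0`, `ρ > 0`,
`ρ^n/((u^a)⁻¹ + ρ^a)^2 = u^(a+b+1) · ((uρ)^n/(1+(uρ)^a)^2)`. [folklore] -/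
theorem stieltjes_scale_sq {n a b : ℕ} (hnab : n + b + 1 = a) {u ρ : ℝ} (hu : 0 < u) (hρ : 0 < ρ) :
    ρ ^ n / ((u ^ a)⁻¹ + ρ ^ a) ^ 2 = u ^ (a + b + 1) * ((u * ρ) ^ n / (1 + (u * ρ) ^ a) ^ 2) := by
  have hua : 0 < u ^ a := pow_pos hu a
  have hd1 : (u ^ a)⁻¹ + ρ ^ a ≠ 0 := (den_pos (inv_pos.2 hua) a hρ.le).ne'
  have hd2 : 1 + (u * ρ) ^ a ≠ 0 := (den_pos one_pos a (mul_pos hu hρ).le).ne'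
  have hu0 : u ≠ 0 := hu.ne'
  have hua0 : u ^ a ≠ 0 := hua.ne'
  subst hnab
  field_simp
  ring

/-- Second scaling: `∫_{ρ>0} ρ^n/((u^a)⁻¹ + ρ^a)^2 dρ = u^(a+b) · ∫_{ρ>0} ρ^n/(1+ρ^a)^2 dρ`. [folklore] -/
theorem integral_stieltjes_sq_scale {n a b : ℕ} (hnab : n + b + 1 = a) {u : ℝ} (hu : 0 < u) :
    ∫ ρ in Ioi (0:ℝ), ρ ^ n / ((u ^ a)⁻¹ + ρ ^ a) ^ 2
      = u ^ (a + b) * ∫ ρ in Ioi (0:ℝ), ρ ^ n / (1 + ρ ^ a) ^ 2 := by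
  have hcongr : EqOn (fun ρ : ℝ => ρ ^ n / ((u ^ a)⁻¹ + ρ ^ a) ^ 2)
      (fun ρ => u ^ (a + b + 1) * ((fun x : ℝ => x ^ n / (1 + x ^ a) ^ 2) (u * ρ))) (Ioi 0) :=
    fun ρ hρ => stieltjes_scale_sq hnab hu hρ
  rw [setIntegral_congr_fun measurableSet_Ioi hcongr, integral_const_mul,
    integral_comp_mul_left_Ioi (fun x : ℝ => x ^ n / (1 + x ^ a) ^ 2) 0 hu, mul_zero, smul_eq_mul,
    ← mul_assoc, pow_succ, mul_assoc (u ^ (a + b)), mul_inv_cancel₀ hu.ne', mul_one]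

/-! ## The integration-by-parts identity `a ∫ ρ^n/(1+ρ^a)^2 = b ∫ ρ^n/(1+ρ^a)` -/

/-- The derivative of `ρ ↦ ρ^(n+1)/(1+ρ^a)` at `ρ ≥ 0` is `a ρ^n/(1+ρ^a)^2 - b ρ^n/(1+ρ^a)`
(`n + b + 1 = a`). [folklore] -/
theorem hasDerivAt_stieltjes_primitive {n a b : ℕ} (hnab : n + b + 1 = a) {ρ : ℝ} (hρ : 0 ≤ ρ) :
    HasDerivAt (fun x : ℝ => x ^ (n + 1) / (1 + x ^ a))
      ((a : ℝ) * (ρ ^ n / (1 + ρ ^ a) ^ 2) - (b : ℝ) * (ρ ^ n / (1 + ρ ^ a))) ρ := by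
  have hden : (1 + ρ ^ a) ≠ 0 := (den_pos one_pos a hρ).ne'
  have h1 : HasDerivAt (fun x : ℝ => x ^ (n + 1)) (((n + 1 : ℕ) : ℝ) * ρ ^ n) ρ := by
    simpa using hasDerivAt_pow (n + 1) ρ
  have h2 : HasDerivAt (fun x : ℝ => 1 + x ^ a) ((a : ℝ) * ρ ^ (a - 1)) ρ := by
    simpa using (hasDerivAt_pow a ρ).const_add 1
  have h : HasDerivAt (fun x : ℝ => x ^ (n + 1) / (1 + x ^ a))
      ((((n + 1 : ℕ) : ℝ) * ρ ^ n * (1 + ρ ^ a) - ρ ^ (n + 1) * ((a : ℝ) * ρ ^ (a - 1)))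
        / (1 + ρ ^ a) ^ 2) ρ := h1.div h2 hden
  refine h.congr_deriv ?_
  subst hnab
  rw [show n + b + 1 - 1 = n + b by omega]
  field_simp
  push_cast
  ring

/-- `ρ^(n+1)/(1+ρ^a) → 0` at `+∞` when `n + b + 1 = a`, `0 < b`. [folklore] -/
theorem tendsto_stieltjes_primitive {n a b : ℕ} (hnab : n + b + 1 = a) (hb : 0 < b) :
    Tendsto (fun x : ℝ => x ^ (n + 1) / (1 + x ^ a)) atTop (𝓝 0) := by
  have hup : Tendsto (fun x : ℝ => (x ^ b)⁻¹) atTop (𝓝 0) :=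
    tendsto_inv_atTop_zero.comp (tendsto_pow_atTop hb.ne')
  refine tendsto_of_tendsto_of_tendsto_of_le_of_le' tendsto_const_nhds hup ?_ ?_
  · filter_upwards [eventually_gt_atTop (0:ℝ)] with x hx
    exact div_nonneg (pow_nonneg hx.le _) (den_pos one_pos a hx.le).le
  · filter_upwards [eventually_gt_atTop (0:ℝ)] with x hx
    have hxb : 0 < x ^ b := pow_pos hx b
    rw [div_le_iff₀ (den_pos one_pos a hx.le), ← div_eq_inv_mul, le_div_iff₀ hxb, ← pow_add]
    subst hnab
    rw [show n + 1 + b = n + b + 1 by ring]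
    have : 0 ≤ x ^ (n + b + 1) := pow_nonneg hx.le _
    linarith

/-- **Integration by parts**: `a · ∫_{ρ>0} ρ^n/(1+ρ^a)^2 dρ = b · ∫_{ρ>0} ρ^n/(1+ρ^a) dρ` for
`n + b + 1 = a`, `0 < b` (the integral over `(0,∞)` of the derivative of `ρ^(n+1)/(1+ρ^a)` vanishes).
[folklore] -/
theorem stieltjes_ibp {n a b : ℕ} (hnab : n + b + 1 = a) (hb : 0 < b) :
    (a : ℝ) * ∫ ρ in Ioi (0:ℝ), ρ ^ n / (1 + ρ ^ a) ^ 2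
      = (b : ℝ) * ∫ ρ in Ioi (0:ℝ), ρ ^ n / (1 + ρ ^ a) := by
  have hna : n + 2 ≤ a := by omega
  have hi1 : IntegrableOn (fun ρ : ℝ => ρ ^ n / (1 + ρ ^ a) ^ 2) (Ioi 0) :=
    integrableOn_stieltjes_sq hna one_pos
  have hi2 : IntegrableOn (fun ρ : ℝ => ρ ^ n / (1 + ρ ^ a)) (Ioi 0) :=
    integrableOn_stieltjes hna one_pos
  have hint : IntegrableOn (fun ρ : ℝ => (a : ℝ) * (ρ ^ n / (1 + ρ ^ a) ^ 2)
      - (b : ℝ) * (ρ ^ n / (1 + ρ ^ a))) (Ioi 0) :=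
    (hi1.const_mul _).sub (hi2.const_mul _)
  have hcont : ContinuousWithinAt (fun x : ℝ => x ^ (n + 1) / (1 + x ^ a)) (Ici 0) 0 := by
    refine ContinuousAt.continuousWithinAt (ContinuousAt.div (by fun_prop) (by fun_prop) ?_)
    have ha0 : a ≠ 0 := by omega
    simp [zero_pow ha0]
  have hFTC := integral_Ioi_of_hasDerivAt_of_tendsto hcont
    (fun x (hx : x ∈ Ioi (0:ℝ)) => hasDerivAt_stieltjes_primitive hnab hx.out.le) hint
    (tendsto_stieltjes_primitive hnab hb)
  rw [zero_pow (Nat.succ_ne_zero n), zero_div, sub_zero, integral_sub (hi1.const_mul _)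
    (hi2.const_mul _), integral_const_mul, integral_const_mul, sub_eq_zero] at hFTC
  exact hFTC

/-- **Second Stieltjes identity**: `∫_{ρ>0} ρ^n/((u^a)⁻¹ + ρ^a)^2 dρ = (b/a) · u^(a+b) · ∫_{ρ>0} ρ^n/(1+ρ^a) dρ`
for `n + b + 1 = a`, `0 < b`, `u > 0` (the derivative `(b/a) w^{-b/a-1}` of the Stieltjes function at
`w = u^{-a}`, natural powers only). [folklore] -/
theorem integral_stieltjes_sq {n a b : ℕ} (hnab : n + b + 1 = a) (hb : 0 < b) {u : ℝ} (hu : 0 < u) :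
    ∫ ρ in Ioi (0:ℝ), ρ ^ n / ((u ^ a)⁻¹ + ρ ^ a) ^ 2
      = ((b : ℝ) / a) * u ^ (a + b) * ∫ ρ in Ioi (0:ℝ), ρ ^ n / (1 + ρ ^ a) := by
  have ha : (a : ℝ) ≠ 0 := by
    have : 0 < a := by omega
    exact_mod_cast this.ne'
  rw [integral_stieltjes_sq_scale hnab hu, div_mul_eq_mul_div, div_mul_eq_mul_div, eq_div_iff ha]
  linear_combination (u ^ (a + b)) * stieltjes_ibp hnab hb

end VLawStieltjes

end Summit.ValiantsHypothesis.ValiantsHypothesis.Theorems.LacunarySymmetroidMatrixDescartes
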